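import Summits.HubbardSuperconductivity.HubbardSuperconductivity.Theses.GibbsMajorant
import Literature.MathematicalPhysics.QuantumLattice.FinDimSpectrumProofs

/-!
# Route `GibbsMajorant`: the support item `EntropyFormSuffices` (stmt-HubbardSuperconductivity-15720)

For Hermitian `H` on a nonempty finite index type, PSD `X`, `β ≥ 0`, `c ≥ 0` and `E₀` below every unit Rayleigh quotient of
`H`: if `Re Tr(e^{-βH}X) ≤ c·exp(−β·Re⟨H⟩_β)` then `exp(βE₀)·Re Tr(e^{-βH}X) ≤ c`.  Proof: `H − E₀·1 ⪰ 0` (the Rayleigh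
hypothesis is exactly the quadratic-form condition), so the Gibbs state — positive and normalised — gives
`Re⟨H⟩_β ≥ E₀`; hence `exp(βE₀)·exp(−β Re⟨H⟩_β) ≤ 1` for `β ≥ 0`.  Finite-dimensional; Tasaki (2020) App. A;
Bratteli–Robinson II §5.3.1.  No definition is introduced.
-/

set_option linter.dupNamespace false

namespace Summit.HubbardSuperconductivity.HubbardSuperconductivity.Theorems.GibbsMajorant

open Matrix
open scoped ComplexOrder

/-- the Gibbs expectation of the energy lies above any lower bound of the unit Rayleigh quotients:
`E₀ ≤ Re⟨H⟩_β`. [folklore] -/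
theorem re_gibbsState_hamiltonian_ge {n : Type} [Fintype n] [DecidableEq n] [Nonempty n]
    {H : Matrix n n ℂ} (hH : H.IsHermitian) (β E₀ : ℝ)
    (hE₀ : ∀ φ : n → ℂ, star φ ⬝ᵥ φ = 1 → E₀ ≤ (star φ ⬝ᵥ H *ᵥ φ).re) :
    E₀ ≤ (Matrix.gibbsState β H H).re := by
  -- (1) the Gibbs expectation of `H` is at least the ground energy (`H − E₀(H)·1 ⪰ 0` and Gibbs positivity)
  have hpsd : (H - ((H.groundEnergy : ℝ) : ℂ) • (1 : Matrix n n ℂ)).PosSemidef := by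
    have h := Matrix.posSemidef_sub_groundEnergy hH
    rw [Algebra.algebraMap_eq_smul_one, RCLike.real_smul_eq_coe_smul (K := ℂ)] at h
    exact h
  have h0 := Matrix.gibbsState_nonneg_of_posSemidef β hH hpsd
  rw [map_sub, map_smul, Matrix.gibbsState_one β H (Matrix.partitionFn_pos β hH).ne', smul_eq_mul, mul_one] at h0
  obtain ⟨hre, -⟩ := Complex.nonneg_iff.mp h0
  rw [Complex.sub_re, Complex.ofReal_re] at hre
  -- (2) `E₀ ≤ E₀(H)`: the ground energy is a unit Rayleigh quotient (of a normalised ground-state vector)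
  have hgs : E₀ ≤ H.groundEnergy := by
    have hne := Matrix.groundSpace_ne_bot_holds hH
    obtain ⟨ψ, hψK, hψ0⟩ := (Submodule.ne_bot_iff _).mp hne
    -- normalise `ψ`
    have hnn : (0 : ℂ) ≤ star ψ ⬝ᵥ ψ := dotProduct_star_self_nonneg ψ
    obtain ⟨hre0, him0⟩ := Complex.nonneg_iff.mp hnn
    have hpos : 0 < (star ψ ⬝ᵥ ψ).re := by
      rcases hre0.eq_or_lt with h | h
      · exfalso; apply hψ0
        have hz : star ψ ⬝ᵥ ψ = 0 := Complex.ext h.symm (by simpa using him0.symm)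
        exact (dotProduct_star_self_eq_zero.mp hz)
      · exact h
    set r : ℝ := (star ψ ⬝ᵥ ψ).re with hr
    have hreal : star ψ ⬝ᵥ ψ = (r : ℂ) := Complex.ext (by simp [hr]) (by simpa using him0.symm)
    have hsq : (Real.sqrt r : ℂ) ≠ 0 := by exact_mod_cast (Real.sqrt_pos.2 hpos).ne'
    set ψ₁ : n → ℂ := ((Real.sqrt r : ℂ)⁻¹) • ψ with hψ₁
    have hψ₁1 : star ψ₁ ⬝ᵥ ψ₁ = 1 := by
      rw [hψ₁, star_smul, smul_dotProduct, dotProduct_smul, smul_eq_mul, smul_eq_mul, hreal]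
      simp only [Complex.star_def, map_inv₀, Complex.conj_ofReal]
      field_simp
      rw [sq, ← Complex.ofReal_mul, Real.mul_self_sqrt hpos.le]
    have hψ₁K : ψ₁ ∈ H.groundSpace := Submodule.smul_mem _ _ hψK
    have hray := (Matrix.rayleigh_eq_groundEnergy_iff_holds hH ψ₁ hψ₁1).2 hψ₁K
    rw [← hray]
    exact hE₀ ψ₁ hψ₁1
  linarith

/-- **`EntropyFormSuffices` holds** (route `GibbsMajorant`, item `stmt-HubbardSuperconductivity-15720`). [folklore] -/
theorem entropyFormSuffices_proof :
    Summit.HubbardSuperconductivity.HubbardSuperconductivity.Theses.GibbsMajorant.EntropyFormSuffices := by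
  unfold Summit.HubbardSuperconductivity.HubbardSuperconductivity.Theses.GibbsMajorant.EntropyFormSuffices
  intro n _ _ _ H X E₀ β c hH hX hβ hc hE₀ hbound
  have hge := re_gibbsState_hamiltonian_ge hH β E₀ hE₀
  have hexp : Real.exp (β * E₀) * Real.exp (-(β * (Matrix.gibbsState β H H).re)) ≤ 1 := by
    rw [← Real.exp_add]
    apply Real.exp_le_one_iff.mpr
    nlinarith
  calc Real.exp (β * E₀) * (Matrix.trace (Matrix.gibbsWeight β H * X)).re
      ≤ Real.exp (β * E₀) * (c * Real.exp (-(β * (Matrix.gibbsState β H H).re))) :=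
        mul_le_mul_of_nonneg_left hbound (Real.exp_pos _).le
    _ = c * (Real.exp (β * E₀) * Real.exp (-(β * (Matrix.gibbsState β H H).re))) := by ring
    _ ≤ c * 1 := mul_le_mul_of_nonneg_left hexp hc
    _ = c := mul_one c

end Summit.HubbardSuperconductivity.HubbardSuperconductivity.Theorems.GibbsMajorant
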